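import Summits.CriticalPhenomena.Ising3DConformalLimit.Theorems.SynchronousCouplingRotationJoiningIsotropyTransferTools
import Summits.CriticalPhenomena.Ising3DConformalLimit.Theorems.SynchronousCouplingRotationJoiningIsotropyNearSmall
import HarnessLib

/-!
# Route `SynchronousCoupling`, crux `RotationJoining` (stmt-CriticalPhenomena-18763), line `SketchIdeator2` (reshape 2) —
# stub F `stub_isotropyTransfer`: the route's cruxes give the asymptotic isotropy of the finite-dimensional block laws

`IsotropyTransfer : TwoPointToolkit → TiltGeometry → BallSums → NewmanBlocks → MomentsToTests → DilationJoinings →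
UniformRegularity → AsymptoticFDDIsotropy`. Proof (method of moments, difference form `MomentsToTests`): for a
critical Gibbs measure `μ` the block vectors `X_{n,i} = ν_n Σ_{tiltCell n m uᵢ} σ`, `Y_{n,i} = α_n Σ_{axisCell n uᵢ} σ`
are bounded and measurable; their coordinates have uniformly sub-Gaussian moments (`subGaussianMoments`: Newman's
Gaussian bound, the axis variance ratio is `1` by translation invariance and the tilted ones converge to `1`); and their
mixed moments agree asymptotically (`mixedMoments_tendsto`: flatten `∏ᵢ Xᵢ^{eᵢ}` to `k = Σeᵢ` blocks, write the
expectation as a smeared `k`-point correlator, odd `k` vanish, even `k = 2q` follow from (A1) `smearedDiff_tendsto`, the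
scale `c_n = ρ_pin(1/n)/n³` with `c_n² V(n) → Φ⁻¹`, `c_n² W(n) → Φ⁻¹` and the abstract endgame `tendsto_sub_of_scaled`).
References: P. Billingsley, *Probability and Measure*, §30; C. M. Newman, Comm. Math. Phys. 41 (1975);
M. Aizenman, H. Duminil-Copin, Ann. Math. 194 (2021). No definitions, no sorry.
-/

noncomputable section

namespace Summit.CriticalPhenomena.Ising3DConformalLimit.Cruxes.RotationJoining.RateSplitting

open MeasureTheory Filter Literature.Probability.LatticeModels Finset
open scoped BigOperators Topology
open Summit.CriticalPhenomena.Ising3DConformalLimit.MoebiusLimitExistsOnlyInteraction (rhoPin rhoPin_sq)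
open Summit.CriticalPhenomena.Ising3DConformalLimit.Cruxes.ExistsScaleCovariantLimit.MonotoneBlockingPort
  (blockCov blockCov_zero_pos)
open Summit.CriticalPhenomena.Ising3DConformalLimit.Theses

/-! ### The tilted pair sums at the scale `c_n` -/

/-- **`c_n² · Σ_{x,y ∈ tiltCell n m u} ⟨σ_xσ_y⟩ → Φ⁻¹` as well** (by (A1) at `k = 2` and translation invariance of the
axis pair sums). [folklore] -/
theorem tendsto_scale_sq_mul_pairSum_tilt (hDJ : SynchronousCoupling.DilationJoinings)
    (hUR : SynchronousCoupling.UniformRegularity) (hBS : BallSums) {μ : Measure (SpinConfig (Site 3))}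
    [IsFiniteMeasure μ] (hcorr : ∀ A : Finset (Site 3), spinCorr μ A = plusCorr 3 (criticalBeta 3) 0 A)
    {sinf : ℝ} (hs : Tendsto (fun n : ℕ => (rhoPin (1 / (n : ℝ)) / (n : ℝ) ^ 3) ^ 2 * blockCov n 0) atTop (𝓝 sinf))
    {m : ℕ} {u : Fin 3 → ℤ} (hu : ∀ i, |u i| ≤ m) :
    Tendsto (fun n : ℕ => (rhoPin (1 / (n : ℝ)) / (n : ℝ) ^ 3) ^ 2 *
      ∑ x ∈ tiltCell n m u, ∑ y ∈ tiltCell n m u, criticalTwoPoint 3 (y - x)) atTop (𝓝 sinf) := by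
  have h := smearedDiff_tendsto hDJ hUR hBS 2 m (fun _ => u) (fun _ i => hu i)
  have key : ∀ n : ℕ,
      (rhoPin (1 / (n : ℝ)) / (n : ℝ) ^ 3) ^ 2 *
          ((∑ y ∈ Fintype.piFinset (fun _ : Fin 2 => axisCell n u), criticalCorr 3 2 (fun l => psiInv (y l))) -
            ∑ y ∈ Fintype.piFinset (fun _ : Fin 2 => axisCell n u), criticalCorr 3 2 y) +
        (rhoPin (1 / (n : ℝ)) / (n : ℝ) ^ 3) ^ 2 * blockCov n 0 =
      (rhoPin (1 / (n : ℝ)) / (n : ℝ) ^ 3) ^ 2 * ∑ x ∈ tiltCell n m u, ∑ y ∈ tiltCell n m u, criticalTwoPoint 3 (y - x) := by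
    intro n
    rw [← sum_piFinset_tiltCell_eq stub_tiltGeometry n m (fun _ : Fin 2 => u) (fun _ i => hu i)
      (fun y => criticalCorr 3 2 y), sum_piFinset_two_eq_pairSum hcorr, sum_piFinset_two_eq_pairSum hcorr,
      pairSum_axisCell]
    ring
  have h2 := h.add hs
  rw [zero_add] at h2
  exact h2.congr key

/-! ### Moments -/

/-- **Asymptotic equality of the self-normalised smeared moments** over tilted and over axis cells, every order `k`
(odd orders vanish identically; even orders by `tendsto_sub_of_scaled`). [folklore] -/
theorem scaledMoments_tendsto (hNB : NewmanBlocks) (hBS : BallSums) (hDJ : SynchronousCoupling.DilationJoinings)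
    (hUR : SynchronousCoupling.UniformRegularity) {μ : Measure (SpinConfig (Site 3))}
    (hμ : μ ∈ isingGibbsMeasures 3 (criticalBeta 3) 0) (k m : ℕ) (w : Fin k → (Fin 3 → ℤ))
    (hw : ∀ l i, |w l i| ≤ m) :
    Tendsto (fun n : ℕ =>
      (normTilt μ n m) ^ k * ∑ y ∈ Fintype.piFinset (fun l => tiltCell n m (w l)), criticalCorr 3 k y -
        (normAxis μ n) ^ k * ∑ y ∈ Fintype.piFinset (fun l => axisCell n (w l)), criticalCorr 3 k y)
      atTop (𝓝 0) := by
  classical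
  obtain ⟨hP, hcorr⟩ := criticalState_of_mem' hμ
  have hTG : TiltGeometry := stub_tiltGeometry
  rcases Nat.even_or_odd k with ⟨q, hq⟩ | hodd
  swap
  · -- odd order: every smeared correlator vanishes
    have h0 : ∀ P : Fin k → Finset (Site 3), ∑ y ∈ Fintype.piFinset P, criticalCorr 3 k y = 0 := fun P =>
      Finset.sum_eq_zero fun y _ => criticalCorr_eq_zero_of_odd (d := 3) le_rfl hodd y
    simp only [h0, mul_zero, sub_zero]
    exact tendsto_const_nhds
  obtain ⟨q, rfl⟩ : ∃ q', k = 2 * q' := ⟨q, by omega⟩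
  clear hq
  obtain ⟨sinf, hsinf, hs⟩ := tendsto_scale_sq_mul_blockCov hDJ hUR
  have h0m : ∀ i, |(0 : Fin 3 → ℤ) i| ≤ (m : ℤ) := fun i => by simp
  have hs' := tendsto_scale_sq_mul_pairSum_tilt hDJ hUR hBS hcorr hs h0m
  -- rewrite the normalisers
  have hν : ∀ n, normTilt μ n m =
      (Real.sqrt (∑ x ∈ tiltCell n m 0, ∑ y ∈ tiltCell n m 0, criticalTwoPoint 3 (y - x)))⁻¹ := fun n => by
    rw [normTilt, integral_blockSum_sq hcorr]
  have key := tendsto_sub_of_scaled (q := q) (c := fun n : ℕ => rhoPin (1 / (n : ℝ)) / (n : ℝ) ^ 3)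
    (V := fun n => blockCov n 0)
    (W := fun n => ∑ x ∈ tiltCell n m 0, ∑ y ∈ tiltCell n m 0, criticalTwoPoint 3 (y - x))
    (SA := fun n => ∑ y ∈ Fintype.piFinset (fun l => axisCell n (w l)), criticalCorr 3 (2 * q) y)
    (ST := fun n => ∑ y ∈ Fintype.piFinset (fun l => tiltCell n m (w l)), criticalCorr 3 (2 * q) y)
    hsinf hs hs' ?_ ?_ ?_
  · refine key.congr fun n => ?_
    simp only [hν, normAxis_eq hcorr]
  · -- (A1): the rescaled smeared difference tends to zero
    have h := smearedDiff_tendsto hDJ hUR hBS (2 * q) m w hw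
    refine h.congr fun n => ?_
    rw [← sum_piFinset_tiltCell_eq hTG n m w hw (fun y => criticalCorr 3 (2 * q) y), pow_mul]
    ring
  · -- the rescaled axis moments are bounded (AM–GM + Newman + `c² V` bounded)
    obtain ⟨Bs, hBs⟩ := (Metric.isBounded_range_of_tendsto _ hs).exists_norm_le
    refine ⟨((2 * q).factorial : ℝ) / (2 ^ q * q.factorial) * Bs ^ q, fun n => ?_⟩
    have hSA0 : 0 ≤ ∑ y ∈ Fintype.piFinset (fun l => axisCell n (w l)), criticalCorr 3 (2 * q) y :=
      Finset.sum_nonneg fun y _ =>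
        Summit.CriticalPhenomena.Ising3DConformalLimit.Theorems.GapForcesFarMerging.Negative.criticalCorr_nonneg' y
    have hc0 : 0 ≤ (rhoPin (1 / (n : ℝ)) / (n : ℝ) ^ 3) ^ 2 := sq_nonneg _
    have hV0 : 0 ≤ blockCov n 0 := by rw [← pairSum_axisCell n 0]; exact pairSum_nonneg _
    have hsn : (rhoPin (1 / (n : ℝ)) / (n : ℝ) ^ 3) ^ 2 * blockCov n 0 ≤ Bs :=
      (Real.le_norm_self _).trans (hBs _ ⟨n, rfl⟩)
    rw [abs_of_nonneg (mul_nonneg (pow_nonneg hc0 q) hSA0), ← integral_prod_blockSum_eq_sum hcorr]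
    have hmom := integral_prod_blockSum_le (hNB μ hμ) rfl (fun l => axisCell n (w l)) (W := blockCov n 0)
      (fun l => by rw [integral_blockSum_sq hcorr, pairSum_axisCell])
    calc ((rhoPin (1 / (n : ℝ)) / (n : ℝ) ^ 3) ^ 2) ^ q * ∫ σ, ∏ l, blockSum (axisCell n (w l)) σ ∂μ
        ≤ ((rhoPin (1 / (n : ℝ)) / (n : ℝ) ^ 3) ^ 2) ^ q *
            (((2 * q).factorial : ℝ) / (2 ^ q * q.factorial) * (blockCov n 0) ^ q) :=
          mul_le_mul_of_nonneg_left hmom (pow_nonneg hc0 q)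
      _ = ((2 * q).factorial : ℝ) / (2 ^ q * q.factorial) *
            ((rhoPin (1 / (n : ℝ)) / (n : ℝ) ^ 3) ^ 2 * blockCov n 0) ^ q := by rw [mul_pow]; ring
      _ ≤ ((2 * q).factorial : ℝ) / (2 ^ q * q.factorial) * Bs ^ q :=
          mul_le_mul_of_nonneg_left (pow_le_pow_left₀ (mul_nonneg hc0 hV0) hsn q) (by positivity)
  · -- positivity of the scale factor and of both variances from `n = 1` on
    filter_upwards [eventually_ge_atTop 1] with n hn
    exact ⟨div_pos (ExistsScaleCovariantLimitNegative.rhoPin_pos' _) (by positivity), blockCov_zero_pos n hn,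
      pairSum_tiltCell_zero_pos hTG hn m⟩

/-- **Mixed moments of the block vectors agree asymptotically** (flattening `∏ᵢ Xᵢ^{eᵢ}` to a product of
`k = Σ eᵢ` blocks and `scaledMoments_tendsto`). [folklore] -/
theorem mixedMoments_tendsto (hNB : NewmanBlocks) (hBS : BallSums) (hDJ : SynchronousCoupling.DilationJoinings)
    (hUR : SynchronousCoupling.UniformRegularity) {μ : Measure (SpinConfig (Site 3))}
    (hμ : μ ∈ isingGibbsMeasures 3 (criticalBeta 3) 0) (j m : ℕ) (us : Fin j → (Fin 3 → ℤ))
    (hus : ∀ i l, |us i l| ≤ m) (e : Fin j → ℕ) :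
    Tendsto (fun n : ℕ =>
      (∫ σ, ∏ i, (normTilt μ n m * blockSum (tiltCell n m (us i)) σ) ^ (e i) ∂μ) -
        ∫ σ, ∏ i, (normAxis μ n * blockSum (axisCell n (us i)) σ) ^ (e i) ∂μ) atTop (𝓝 0) := by
  classical
  obtain ⟨hP, hcorr⟩ := criticalState_of_mem' hμ
  have hflat : ∀ (a : ℝ) (S : Fin j → Finset (Site 3)) (σ : SpinConfig (Site 3)),
      ∏ i, (a * blockSum (S i) σ) ^ (e i) =
        a ^ (∑ i, e i) * ∏ l : Fin (∑ i, e i), blockSum (S ((finSigmaFinEquiv (n := e)).symm l).1) σ := by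
    intro a S σ
    rw [Finset.prod_congr rfl fun i _ => mul_pow a (blockSum (S i) σ) (e i), Finset.prod_mul_distrib,
      Finset.prod_pow_eq_pow_sum, prod_pow_eq_prod_flatten e (fun i => blockSum (S i) σ)]
  have hX : ∀ n, ∫ σ, ∏ i, (normTilt μ n m * blockSum (tiltCell n m (us i)) σ) ^ (e i) ∂μ =
      (normTilt μ n m) ^ (∑ i, e i) *
        ∑ y ∈ Fintype.piFinset (fun l : Fin (∑ i, e i) => tiltCell n m (us ((finSigmaFinEquiv (n := e)).symm l).1)),
          criticalCorr 3 (∑ i, e i) y := by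
    intro n
    rw [← integral_prod_blockSum_eq_sum hcorr, ← integral_const_mul]
    exact integral_congr_ae (Eventually.of_forall fun σ => hflat _ (fun i => tiltCell n m (us i)) σ)
  have hY : ∀ n, ∫ σ, ∏ i, (normAxis μ n * blockSum (axisCell n (us i)) σ) ^ (e i) ∂μ =
      (normAxis μ n) ^ (∑ i, e i) *
        ∑ y ∈ Fintype.piFinset (fun l : Fin (∑ i, e i) => axisCell n (us ((finSigmaFinEquiv (n := e)).symm l).1)),
          criticalCorr 3 (∑ i, e i) y := by
    intro n
    rw [← integral_prod_blockSum_eq_sum hcorr, ← integral_const_mul]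
    exact integral_congr_ae (Eventually.of_forall fun σ => hflat _ (fun i => axisCell n (us i)) σ)
  simp_rw [hX, hY]
  exact scaledMoments_tendsto hNB hBS hDJ hUR hμ (∑ i, e i) m
    (fun l => us ((finSigmaFinEquiv (n := e)).symm l).1) (fun l i => hus _ i)

/-- **Uniform sub-Gaussian moments of both block vectors**: `E[X_{n,i}^{2k}], E[Y_{n,i}^{2k}] ≤ (Kk)ᵏ` with one `K`
(Newman's bound; the axis variance ratio is `1` by translation invariance, the tilted ones converge to `1` by (A1)
at `k = 2`, hence are bounded). [cite: Newman1975, Thm 3] -/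
theorem subGaussianMoments (hNB : NewmanBlocks) (hBS : BallSums) (hDJ : SynchronousCoupling.DilationJoinings)
    (hUR : SynchronousCoupling.UniformRegularity) {μ : Measure (SpinConfig (Site 3))}
    (hμ : μ ∈ isingGibbsMeasures 3 (criticalBeta 3) 0) (j m : ℕ) (us : Fin j → (Fin 3 → ℤ))
    (hus : ∀ i l, |us i l| ≤ m) :
    ∃ K : ℝ, ∀ (n : ℕ) (i : Fin j) (k : ℕ),
      ∫ σ, (normTilt μ n m * blockSum (tiltCell n m (us i)) σ) ^ (2 * k) ∂μ ≤ (K * k) ^ k ∧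
        ∫ σ, (normAxis μ n * blockSum (axisCell n (us i)) σ) ^ (2 * k) ∂μ ≤ (K * k) ^ k := by
  classical
  obtain ⟨hP, hcorr⟩ := criticalState_of_mem' hμ
  have hTG : TiltGeometry := stub_tiltGeometry
  obtain ⟨sinf, hsinf, hs⟩ := tendsto_scale_sq_mul_blockCov hDJ hUR
  have h0m : ∀ i, |(0 : Fin 3 → ℤ) i| ≤ (m : ℤ) := fun i => by simp
  have hs' := tendsto_scale_sq_mul_pairSum_tilt hDJ hUR hBS hcorr hs h0m
  -- the tilted variance ratios converge to `1`, hence are bounded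
  have hratio : ∀ i : Fin j, ∃ R : ℝ, ∀ n : ℕ,
      (normTilt μ n m) ^ 2 * ∫ σ, (blockSum (tiltCell n m (us i)) σ) ^ 2 ∂μ ≤ R := by
    intro i
    have hsi := tendsto_scale_sq_mul_pairSum_tilt hDJ hUR hBS hcorr hs (fun l => hus i l)
    have hlim : Tendsto (fun n : ℕ => (normTilt μ n m) ^ 2 * ∫ σ, (blockSum (tiltCell n m (us i)) σ) ^ 2 ∂μ)
        atTop (𝓝 1) := by
      have h := hsi.div hs' hsinf.ne'
      rw [div_self hsinf.ne'] at h
      refine h.congr' ?_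
      filter_upwards [eventually_ge_atTop 1] with n hn
      have hc : 0 < rhoPin (1 / (n : ℝ)) / (n : ℝ) ^ 3 :=
        div_pos (ExistsScaleCovariantLimitNegative.rhoPin_pos' _) (by positivity)
      have hW := pairSum_tiltCell_zero_pos hTG hn m
      have hρ : rhoPin (1 / (n : ℝ)) ≠ 0 := (ExistsScaleCovariantLimitNegative.rhoPin_pos' _).ne'
      have hn0 : (n : ℝ) ≠ 0 := by exact_mod_cast (show n ≠ 0 by omega)
      have hW0 : ∑ x ∈ tiltCell n m 0, ∑ y ∈ tiltCell n m 0, criticalTwoPoint 3 (y - x) ≠ 0 := hW.ne'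
      rw [Pi.div_apply, normTilt, integral_blockSum_sq hcorr, integral_blockSum_sq hcorr, inv_pow,
        Real.sq_sqrt hW.le]
      field_simp
    obtain ⟨R, hR⟩ := (Metric.isBounded_range_of_tendsto _ hlim).exists_norm_le
    exact ⟨R, fun n => (Real.le_norm_self _).trans (hR _ ⟨n, rfl⟩)⟩
  choose R hR using hratio
  have hK1 : (1 : ℝ) ≤ 1 + ∑ i, |R i| := le_add_of_nonneg_right (Finset.sum_nonneg fun i _ => abs_nonneg _)
  refine ⟨1 + ∑ i, |R i|, fun n i k => ⟨?_, ?_⟩⟩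
  · refine integral_pow_const_mul_blockSum_le (hNB μ hμ) _ _ ((hR i n).trans ?_) k
    calc R i ≤ |R i| := le_abs_self _
      _ ≤ ∑ i', |R i'| := Finset.single_le_sum (fun i' _ => abs_nonneg (R i')) (Finset.mem_univ i)
      _ ≤ 1 + ∑ i', |R i'| := by linarith
  · refine integral_pow_const_mul_blockSum_le (hNB μ hμ) _ _ (le_trans ?_ hK1) k
    rw [normAxis_eq hcorr, integral_blockSum_sq hcorr, pairSum_axisCell, inv_pow,
      Real.sq_sqrt (by rw [← pairSum_axisCell n 0]; exact pairSum_nonneg _)]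
    by_cases hV : blockCov n 0 = 0
    · simp [hV]
    · rw [inv_mul_cancel₀ hV]

/-- **Reshape 2, stub F: `IsotropyTransfer`.** The route's cruxes `DilationJoinings ∧ UniformRegularity` give — through
the tree's pinned scaling limit and its rotation invariance ((A1) `smearedDiff_tendsto`), Newman's Gaussian bound and
the method of moments — the asymptotic isotropy of the finite-dimensional block laws `AsymptoticFDDIsotropy`. -/
theorem stub_isotropyTransfer' : IsotropyTransfer := by
  intro _hTK _hTG hBS hNB hMT hDJ hUR μ hμ _hTI j m us hus f hf hfB
  obtain ⟨hP, _⟩ := criticalState_of_mem' hμ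
  refine hMT (SpinConfig (Site 3)) μ j (fun n σ i => normTilt μ n m * blockSum (tiltCell n m (us i)) σ)
    (fun n σ i => normAxis μ n * blockSum (axisCell n (us i)) σ)
    (fun n => measurable_pi_lambda _ fun i => measurable_const_mul_blockSum _ _)
    (fun n => measurable_pi_lambda _ fun i => measurable_const_mul_blockSum _ _)
    (fun n => ?_) (subGaussianMoments hNB hBS hDJ hUR hμ j m us hus)
    (mixedMoments_tendsto hNB hBS hDJ hUR hμ j m us hus) f hf.continuous hfB
  -- uniform bounds at fixed `n`
  refine ⟨∑ i, (|normTilt μ n m| * (tiltCell n m (us i)).card + |normAxis μ n| * (axisCell n (us i)).card),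
    fun σ i => ⟨?_, ?_⟩⟩
  · calc |normTilt μ n m * blockSum (tiltCell n m (us i)) σ|
        ≤ |normTilt μ n m| * (tiltCell n m (us i)).card := by
          rw [abs_mul]; exact mul_le_mul_of_nonneg_left (abs_blockSum_le _ σ) (abs_nonneg _)
      _ ≤ |normTilt μ n m| * (tiltCell n m (us i)).card + |normAxis μ n| * (axisCell n (us i)).card :=
          le_add_of_nonneg_right (by positivity)
      _ ≤ ∑ i, (|normTilt μ n m| * (tiltCell n m (us i)).card + |normAxis μ n| * (axisCell n (us i)).card) :=
          Finset.single_le_sum (f := fun i => |normTilt μ n m| * ((tiltCell n m (us i)).card : ℝ) +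
            |normAxis μ n| * ((axisCell n (us i)).card : ℝ)) (fun i _ => by positivity) (Finset.mem_univ i)
  · calc |normAxis μ n * blockSum (axisCell n (us i)) σ|
        ≤ |normAxis μ n| * (axisCell n (us i)).card := by
          rw [abs_mul]; exact mul_le_mul_of_nonneg_left (abs_blockSum_le _ σ) (abs_nonneg _)
      _ ≤ |normTilt μ n m| * (tiltCell n m (us i)).card + |normAxis μ n| * (axisCell n (us i)).card :=
          le_add_of_nonneg_left (by positivity)
      _ ≤ ∑ i, (|normTilt μ n m| * (tiltCell n m (us i)).card + |normAxis μ n| * (axisCell n (us i)).card) :=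
          Finset.single_le_sum (f := fun i => |normTilt μ n m| * ((tiltCell n m (us i)).card : ℝ) +
            |normAxis μ n| * ((axisCell n (us i)).card : ℝ)) (fun i _ => by positivity) (Finset.mem_univ i)

/-- **Registered stub `stub_isotropyTransfer`** of the line `SketchIdeator2` (reshape 2). -/
theorem stub_isotropyTransfer : Sig.stub_isotropyTransfer := stub_isotropyTransfer'

end Summit.CriticalPhenomena.Ising3DConformalLimit.Cruxes.RotationJoining.RateSplitting

end
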